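/-
Copyright (c) 2026 the pub-hodgecm-mathlib formalisation cell (harness21).  Prover seat hodgecm-mathlib-K2Liu-p14 (g2): Track B «K2-LIT»,
hLiu418 = stmt-HodgeConjecture-24832; K2E5-plan (g7) 10:32:10Z «(β4-v) IS YOURS» (LEAD F0P6-plan lineage RULING M-157b (β)), file (β4-v) E (the capstone of G5 (β)).
-/
import Summits.HodgeConjecture.HodgeConjecture.Theorems.K2LiuGL2GodementSectionsExhaustGlobal   -- ★ (β4-iii)
import Summits.HodgeConjecture.HodgeConjecture.Theorems.K2LiuGL2FlatSectionGodementData        -- ★ (β4-v) D2b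
import HarnessLib

/-!
# Crux `HLiu418`, road `K2_Liu`, Road Φ organ G5 (β) «Godement sections exhaust the flat sections», file (β4-v) E — THE CAPSTONE:
# FLAT `K`-FINITE SECTION FAMILIES OF `Ind_B^{GL₂(𝔸_L)}(|·|^{s+½}, |·|^{−(s+½)})` ARE FINITE COMBINATIONS OF GODEMENT SECTIONS (totally complex `L`)

Cell `hodgecm-mathlib`, crux item hLiu418 = `stmt-HodgeConjecture-24832`; prover K2Liu-p14 (g2).  THEOREMS ONLY (no `def`, no instance, no notation,
no named-fact hypothesis, no `sorry`); lane `--supports stmt-HodgeConjecture-24832` (count-neutral helper).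
ONE THEOREM from the (β0) face to ★ (γ)'s junction: for a finite family of section families `b i : ℂ → GL₂(𝔸_L) → ℂ` obeying the law (T)(N) of
`Ind(|·|^{s+½}, |·|^{−(s+½)})` for `0 < re s` and FLAT — `b i s|_K = B i` independent of `s` on `K = K_∞·GL₂(𝒪̂_L)` — with `B i` left-invariant under the upper-triangular
elements of `K`, of level `K′_f = ∏_{v∈S} K_{γ_v} × ∏_{v∉S} GL₂(𝒪_v)`, continuous on `K` and `K`-finite, **`exists_godement_exhaust_of_flat`** produces a finite index type `J`,
Schwartz–Bruhat functions `Φ i j ∈ piSchwartzBruhat L (Fin 2)` and coefficients `κ i j` HOLOMORPHIC and LOCALLY BOUNDED on `{0 < re s}` with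
  `b i s g = Σ_j κ i j s · |det g|^{s+½} · Z(Φ i j; s+½; e₂ g)`   (`0 < re s`, all `g`)
— LITERALLY the `hΦ`∕`hb`∕`hκ`∕`hκ` inputs of ★ `K2LiuMiddleCellGodementJunction.middle_eq_sum_mirabolicEisenstein` ∕ `had_of_face` ∕ `hag_of_face` at `e₀ = Pi.single 1 1`.
Proof: ★ (β4-v) D2b `exists_godement_data` for each `B i`, reindexed over the common finite type `J = Σ_i Σ_n ι_{i,n}` (the finite coefficients of `b i` vanish off the
`i`-th summand), fed into ★ (β4-iii) `exists_godement_exhaust`; `Φ i j ∈ piSchwartzBruhat` by ★ `tensor_mem_piSchwartzBruhat`.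
[cite: JacquetLanglands1970, §3, §5–§6, §11] [cite: MoeglinWaldspurger1995, II.1.7, IV.1.9] [cite: Bump1997, §3.7] [cite: CogdellAnalyticTheory2004, §2.3] [cite: Tate1950, §2.5, §4.4].
HONEST LABEL.  `HC_CM` is proved only modulo the 7 printed citations (2 remaining named inputs: hLiu418 = `stmt-HodgeConjecture-24832`,
h413 = `stmt-HodgeConjecture-24833`) until rung 0 closes.
-/

set_option autoImplicit false
set_option linter.dupNamespace false -- the mandated namespace repeats `HodgeConjecture.HodgeConjecture`

noncomputable section

open MeasureTheory Measure NumberField NumberField.InfinitePlace NumberField.mixedEmbedding IsDedekindDomain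
open scoped NNReal ENNReal Classical Matrix
open Literature.NumberTheory.Automorphic
open Literature.NumberTheory.GaloisRepresentations (ideleGroup)
open Summit.HodgeConjecture.HodgeConjecture.Cruxes.HLiu418.K2LiuGL2GodementSectionsExhaustGlobal (exists_godement_exhaust)
open Summit.HodgeConjecture.HodgeConjecture.Cruxes.HLiu418.K2LiuGL2FlatSectionGodementData (exists_godement_data)

namespace Summit.HodgeConjecture.HodgeConjecture.Cruxes.HLiu418.K2LiuGL2FlatSectionsGodementExhaust

/-! ## §1 Reindexing a double sum over a sigma type -/

/-- collecting the `i`-th block of a sum over `Σ_{i'} Σ_n ι_{i',n}` whose other blocks are killed by an indicator. [folklore] -/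
theorem sum_sigma_ite_eq {I : Type} [Fintype I] {N : I → ℕ} {M : Type*} (ι : ∀ i, Fin (N i) → Finset M)
    (T : ∀ i, Fin (N i) → M → ℂ) (β : ∀ i, Fin (N i) → ℂ) (i : I) :
    ∑ j : (Σ i' : I, Σ n : Fin (N i'), ↥(ι i' n)), T j.1 j.2.1 j.2.2 * (if j.1 = i then β j.1 j.2.1 else 0) =
      ∑ n : Fin (N i), (∑ m ∈ ι i n, T i n m) * β i n := by
  rw [Fintype.sum_sigma, Finset.sum_eq_single i (fun i' _ hi' => by simp [hi']) (fun h => (h (Finset.mem_univ i)).elim)]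
  simp only [if_true]
  rw [Fintype.sum_sigma]
  refine Finset.sum_congr rfl fun n _ => ?_
  rw [Finset.sum_mul, ← Finset.sum_coe_sort (ι i n)]

/-! ## §2 The capstone -/

variable {L : Type} [Field L] [NumberField L] [IsTotallyComplex L]
variable [MeasurableSpace (AdeleRing (𝓞 L) L)] [BorelSpace (AdeleRing (𝓞 L) L)]

/-- **FLAT `K`-FINITE SECTION FAMILIES ARE FINITE COMBINATIONS OF GODEMENT SECTIONS, WITH COEFFICIENTS HOLOMORPHIC AND LOCALLY BOUNDED ON `{0 < re s}`**
(RULING M-157b (β); the `hΦ`∕`hb`∕`hκ`∕`hκ` inputs of ★ (γ)'s junction `K2LiuMiddleCellGodementJunction.middle_eq_sum_mirabolicEisenstein` ∕ `had_of_face` ∕ `hag_of_face`).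
DATA: a totally complex `L`, Haar measures `ν` on `𝕀_L` and `μ_∞` on `K_∞ˣ`, a level (`S`, `0 ≠ γ_v < 1`), section families `b i` (`i ∈ I` finite) and their flat
`K`-restrictions `B i`.  HYPOTHESES: (T) `hT` ∕ (N) `hN` the section law; `hbK : b i s k = B i k` on `K` (`0 < re s`); `hBK`, `hlev`, `hcont`, `hfin` on `B i` (left
invariance under upper-triangular elements of `K`, right-`K′_f`-invariance, continuity, `K`-finiteness).  CONCLUSION: `∃ J` finite, `κ : I → J → ℂ → ℂ`,
`Φ : I → J → (𝔸_L² → ℂ)` with `Φ i j ∈ piSchwartzBruhat L (Fin 2)`, `κ i j` holomorphic on `{0 < re}`, bounded near every `z` with `0 < re z` uniformly in `(i, j)`, and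
`b i s g = Σ_j κ i j s · |det g|^{s+½} · tateVectorIntegral L ν (Φ i j) (s+½) (ratVec L (Pi.single 1 1) ᵥ* g)` for `0 < re s` and every `g ∈ GL₂(𝔸_L)`.
[cite: JacquetLanglands1970, §3, §5–§6, §11] [cite: MoeglinWaldspurger1995, II.1.7, IV.1.9] [cite: Bump1997, §3.7] [cite: CogdellAnalyticTheory2004, §2.3] -/
theorem exists_godement_exhaust_of_flat (ν : Measure (ideleGroup L)) [ν.IsHaarMeasure] (μinf : Measure (mixedSpace L)ˣ) [μinf.IsHaarMeasure]
    (S : Finset (HeightOneSpectrum (𝓞 L))) (γ : ∀ v : HeightOneSpectrum (𝓞 L), ValuativeRel.ValueGroupWithZero (v.adicCompletion L))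
    (hγ0 : ∀ v ∈ S, γ v ≠ 0) (hγ1 : ∀ v ∈ S, γ v < 1) {I : Type} [Fintype I]
    (b : I → ℂ → GL (Fin 2) (AdeleRing (𝓞 L) L) → ℂ) (B : I → GL (Fin 2) (AdeleRing (𝓞 L) L) → ℂ)
    (hT : ∀ (i : I) (s : ℂ), 0 < s.re → ∀ (d : Fin 2 → (AdeleRing (𝓞 L) L)ˣ) (g : GL (Fin 2) (AdeleRing (𝓞 L) L)),
      b i s (glDiagonal 2 (AdeleRing (𝓞 L) L) d * g) =
        ((IdeleClassGroup.ideleNorm L (d 0) : ℝ) : ℂ) ^ (s + 1 / 2) * ((IdeleClassGroup.ideleNorm L (d 1) : ℝ) : ℂ) ^ (-(s + 1 / 2)) * b i s g)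
    (hN : ∀ (i : I) (s : ℂ), 0 < s.re → ∀ (u g : GL (Fin 2) (AdeleRing (𝓞 L) L)), (u : Matrix (Fin 2) (Fin 2) (AdeleRing (𝓞 L) L)) 1 0 = 0 →
      (u : Matrix (Fin 2) (Fin 2) (AdeleRing (𝓞 L) L)) 0 0 = 1 → (u : Matrix (Fin 2) (Fin 2) (AdeleRing (𝓞 L) L)) 1 1 = 1 → b i s (u * g) = b i s g)
    (hbK : ∀ (i : I) (s : ℂ), 0 < s.re → ∀ k ∈ standardMaximalCompactGL 2 L, b i s k = B i k)
    (hBK : ∀ (i : I), ∀ p ∈ standardMaximalCompactGL 2 L, ∀ k ∈ standardMaximalCompactGL 2 L,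
      (p : Matrix (Fin 2) (Fin 2) (AdeleRing (𝓞 L) L)) 1 0 = 0 → B i (p * k) = B i k)
    (hlev : ∀ (i : I), ∀ k ∈ standardMaximalCompactGL 2 L, ∀ r ∈ glFiniteIntegralLevel 2 L, (∀ v ∈ S, GLn.evalAt 2 L v r ∈ congruenceGL 2 (γ v)) →
      B i (k * GLn.ofFinite 2 L r) = B i k)
    (hcont : ∀ i, Continuous fun k : ↥(standardMaximalCompactGL 2 L) => B i k)
    (hfin : ∀ i, FiniteDimensional ℂ (Submodule.span ℂ (Set.range fun k₀ : ↥(standardMaximalCompactGL 2 L) =>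
      fun k : ↥(standardMaximalCompactGL 2 L) => B i ((k : GL (Fin 2) (AdeleRing (𝓞 L) L)) * k₀)))) :
    ∃ (J : Type) (_ : Fintype J) (κ : I → J → ℂ → ℂ) (Φ : I → J → (Fin 2 → AdeleRing (𝓞 L) L) → ℂ),
      (∀ i j, Φ i j ∈ piSchwartzBruhat L (Fin 2)) ∧
      (∀ i j, DifferentiableOn ℂ (κ i j) {s : ℂ | 0 < s.re}) ∧
      (∀ z : ℂ, 0 < z.re → ∃ C r : ℝ, 0 ≤ C ∧ 0 < r ∧ ∀ s : ℂ, dist s z < r → ∀ i j, ‖κ i j s‖ ≤ C) ∧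
      ∀ (i : I) (s : ℂ) (g : GL (Fin 2) (AdeleRing (𝓞 L) L)), 0 < s.re →
        b i s g = ∑ j, κ i j s *
          (((IdeleClassGroup.ideleNorm L (Matrix.GeneralLinearGroup.det g) : ℝ) : ℂ) ^ (s + 1 / 2) *
            tateVectorIntegral L ν (Φ i j) (s + 1 / 2) (ratVec L (Pi.single 1 1) ᵥ* (g : Matrix (Fin 2) (Fin 2) (AdeleRing (𝓞 L) L)))) := by
  haveI : HasSummableGeomSeries (mixedSpace L) := Literature.MeasureTheory.Group.hasSummableGeomSeries_of_finiteDimensional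
  haveI : BorelSpace (mixedSpace L)ˣ := Literature.MeasureTheory.Group.Units.borelSpace_of_isOpenEmbedding
  -- ★ D2b for each `B i`
  choose N ι Φinf A Φfin βf hΦfin hAinv hgi hfinval hK using fun i => exists_godement_data μinf S γ hγ0 hγ1 (B i) (hBK i) (hlev i) (hcont i) (hfin i)
  -- the common index type and the reindexed data (finite coefficients of `b i` vanish off the `i`-th block)
  let J : Type := Σ i : I, Σ n : Fin (N i), ↥(ι i n)
  let Φinf' : I → J → SchwartzMap (Fin 2 → mixedSpace L) ℂ := fun _ j => Φinf j.1 j.2.1 j.2.2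
  let A' : I → J → ℂ → ℂ := fun _ j => A j.1 j.2.1 j.2.2
  let βf' : I → J → GL (Fin 2) (FiniteAdeleRing (𝓞 L) L) → ℂ := fun i j kf => if j.1 = i then βf j.1 j.2.1 kf else 0
  let Φfin' : I → J → (Fin 2 → FiniteAdeleRing (𝓞 L) L) → ℂ := fun i j x => if j.1 = i then Φfin j.1 j.2.1 x else 0
  -- ★ (β4-iii)
  obtain ⟨κ, hκd, hκb, hval⟩ := exists_godement_exhaust ν μinf S b Φinf' Φfin' A' βf' hT hN
    (fun i s hs k hk => by
      have hs' : 0 < (2 * s + 1).re := by simp only [Complex.add_re, Complex.mul_re]; norm_num; linarith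
      rw [hbK i s hs k hk, hK i (2 * s + 1) hs' k hk]
      exact (sum_sigma_ite_eq ι (fun i' n m => (A i' n m (2 * s + 1))⁻¹ *
        ∫ x : (mixedSpace L)ˣ, Φinf i' n m (fun l => (x : mixedSpace L) *
          ((GLn.toMixed 2 L k : GL (Fin 2) (mixedSpace L)) : Matrix (Fin 2) (Fin 2) (mixedSpace L)) 1 l) *
            ((mixedEmbedding.norm ((x : (mixedSpace L)ˣ) : mixedSpace L) : ℝ) : ℂ) ^ (2 * s + 1) ∂μinf)
        (fun i' n => βf i' n (GLn.sndHom 2 L k)) i).symm)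
    (fun i j w hw k hk => hgi j.1 j.2.1 j.2.2 j.2.2.2 w (by linarith) k hk)
    (fun i j => (hAinv j.1 j.2.1 j.2.2).differentiableOn)
    (fun i j a kf hkf => by
      by_cases hji : j.1 = i
      · simp only [Φfin', βf', hji, if_true]
        exact hfinval j.1 j.2.1 a kf hkf
      · simp only [Φfin', βf', hji, if_false, mul_zero])
  refine ⟨J, inferInstance, κ, fun i j v => Φinf' i j (piArch L (Fin 2) v) * Φfin' i j (piFinite L (Fin 2) v), fun i j => ?_, hκd, hκb, hval⟩
  -- `Φ i j ∈ piSchwartzBruhat`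
  beta_reduce
  by_cases hji : j.1 = i
  · have h := tensor_mem_piSchwartzBruhat (Φinf' i j) (hΦfin j.1 j.2.1)
    simp only [Φfin', hji, if_true]
    exact h
  · have h0 : (fun v : Fin 2 → AdeleRing (𝓞 L) L => Φinf' i j (piArch L (Fin 2) v) * Φfin' i j (piFinite L (Fin 2) v)) = 0 := by
      funext v
      simp only [Φfin', hji, if_false, mul_zero, Pi.zero_apply]
    rw [h0]
    exact Submodule.zero_mem _

end Summit.HodgeConjecture.HodgeConjecture.Cruxes.HLiu418.K2LiuGL2FlatSectionsGodementExhaust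

end
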